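import Mathlib.Probability.Distributions.Gaussian.Multivariate
import Mathlib.MeasureTheory.Measure.CharacteristicFunction.Basic
import Mathlib.Algebra.QuadraticDiscriminant
import HarnessLib

/-!
# The Minlos–Sazonov finite-dimensional estimate

Support file for the discharge of Minlos' theorem (`Literature.Analysis.FunctionSpaces.minlos`,
`Literature.Analysis.FunctionSpaces.Minlos`; proofs in `…/MinlosProofs.lean`). It contains the
finite-dimensional probabilistic core of Minlos' proof, in the Gaussian-integration form of
Yamasaki, *Measures on infinite dimensional spaces* (1985), Part A §17, proof of Thm 17.1,
(17.3)–(17.7): if the characteristic function `ν̂` of a probability measure `ν` on `ℝ^ι`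
satisfies `1 - Re ν̂(t) ≤ ε + 2 ∑ₙ ⟪aₙ, t⟫²`, where the linear forms `⟪aₙ, ·⟫` are dominated by a
positive semidefinite quadratic form `tᵀ M t` with square-summable constants
(`⟪aₙ, t⟫² ≤ bₙ² tᵀ M t`, `∑ bₙ² ≤ C`), then for every `R > 0`

  `ν {y | ∃ t, ⟪y, t⟫² > R² tᵀ M t} ≤ (ε + 2 C / R²) / (1 - e^{-1/2})`

(`Literature.Analysis.FunctionSpaces.MinlosSazonov.measure_setOf_sq_inner_gt_le`). In the application (`MinlosProofs`) `ν` is a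
finite-dimensional marginal of the Kolmogorov measure of a characteristic functional on a nuclear
space, `M` is the Gram matrix of a Hilbert–Schmidt dominating seminorm and the event is "the
sample function violates `|ω(x)| ≤ R q(x)` for some `x` in a finite-dimensional subspace".

## Proof

For `δ > 0` let `γ_δ` be the centred Gaussian on `ℝ^ι` with covariance `R⁻² (M + δ)⁻¹`
(Mathlib `ProbabilityTheory.multivariateGaussian`). Fubini gives
`∫ (1 - Re ν̂) dγ_δ = ∫ (1 - exp (-yᵀ S y / 2)) dν(y)` (`integral_one_sub_re_charFun`), the
hypothesis and `∫ ⟪aₙ, t⟫² dγ_δ = aₙᵀ S aₙ ≤ bₙ² / R²` bound the left side by `ε + 2C/R²`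
(`integral_tsum_sq_inner_le`, `dotProduct_inv_mulVec_le`), and Markov's inequality bounds
`ν {y | yᵀ (M+δ)⁻¹ y > R²}`; finally `δ → 0` through `δ = 1/(k+1)` exhausts the target event
(`lt_dotProduct_inv_mulVec`, a Cauchy–Schwarz argument for the degenerate form `M`).

## References

* Y. Yamasaki, *Measures on infinite dimensional spaces*, World Scientific (1985), Part A §17,
  Thm 17.1 and its proof, (17.3)–(17.7); §18 Thm 18.2.
* R. A. Minlos, *Generalized random processes and their extension to a measure*, Trudy Moskov.
  Mat. Obšč. 8 (1959), 497–518.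
* V. Sazonov, *A remark on characteristic functionals*, Teor. Veroyatn. Primen. 3 (1958).

## Mathlib

Used: `ProbabilityTheory.multivariateGaussian` with `charFun_multivariateGaussian`,
`covarianceBilin_multivariateGaussian`, `IsGaussian.memLp_two_id`; `MeasureTheory.charFun`,
`integral_integral_swap` (Fubini), `mul_meas_ge_le_integral_of_nonneg` (Markov),
`Matrix.PosDef`/`PosSemidef`, `discrim_le_zero`.
-/

open scoped RealInnerProductSpace NNReal ENNReal
open MeasureTheory ProbabilityTheory Complex WithLp Matrix

namespace Literature.Analysis.FunctionSpaces

namespace MinlosSazonov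

variable {ι : Type*} [Fintype ι]
/-! ### Matrix lemmas: Cauchy–Schwarz for positive semidefinite real matrices -/

/-- Symmetry `uᵀ A t = tᵀ A u` of the bilinear form of a real symmetric matrix. [folklore] -/
theorem dotProduct_mulVec_comm {A : Matrix ι ι ℝ} (hA : A.IsHermitian) (u t : ι → ℝ) :
    u ⬝ᵥ A *ᵥ t = t ⬝ᵥ A *ᵥ u := by
  have hT : Aᵀ = A := by
    have := hA.eq
    rwa [Matrix.conjTranspose_eq_transpose_of_trivial] at this
  rw [Matrix.dotProduct_mulVec, ← Matrix.mulVec_transpose, hT, dotProduct_comm]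

/-- Cauchy–Schwarz for the (possibly degenerate) bilinear form of a positive semidefinite real
matrix (discriminant argument). [folklore] -/
theorem sq_dotProduct_mulVec_le {A : Matrix ι ι ℝ} (hA : A.PosSemidef) (u t : ι → ℝ) :
    (u ⬝ᵥ A *ᵥ t) ^ 2 ≤ (u ⬝ᵥ A *ᵥ u) * (t ⬝ᵥ A *ᵥ t) := by
  have hsymm := dotProduct_mulVec_comm hA.1
  have hq : ∀ s : ℝ, 0 ≤ (t ⬝ᵥ A *ᵥ t) * (s * s) + (2 * (u ⬝ᵥ A *ᵥ t)) * s + u ⬝ᵥ A *ᵥ u := by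
    intro s
    have h0 := hA.dotProduct_mulVec_nonneg (u + s • t)
    simp only [star_trivial, Matrix.mulVec_add, Matrix.mulVec_smul, dotProduct_add,
      add_dotProduct, dotProduct_smul, smul_dotProduct, smul_eq_mul] at h0
    have h1 := hsymm t u
    rw [h1] at h0
    nlinarith [h0]
  have hd := discrim_le_zero hq
  rw [discrim] at hd
  nlinarith [hd]

/-- If `(a ⬝ t)² ≤ c · tᵀ A t` for all `t` and `A` is positive definite, then `aᵀ A⁻¹ a ≤ c`
(take `t = A⁻¹ a`). [folklore] -/
theorem dotProduct_inv_mulVec_le [DecidableEq ι] {A : Matrix ι ι ℝ} (hA : A.PosDef) {a : ι → ℝ}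
    {c : ℝ} (hc : 0 ≤ c) (h : ∀ t, (a ⬝ᵥ t) ^ 2 ≤ c * (t ⬝ᵥ A *ᵥ t)) :
    a ⬝ᵥ A⁻¹ *ᵥ a ≤ c := by
  have hdet : IsUnit A.det := (Matrix.isUnit_iff_isUnit_det _).1 hA.isUnit
  set N := a ⬝ᵥ A⁻¹ *ᵥ a with hN
  have h1 := h (A⁻¹ *ᵥ a)
  have h2 : (A⁻¹ *ᵥ a) ⬝ᵥ A *ᵥ (A⁻¹ *ᵥ a) = N := by
    rw [Matrix.mulVec_mulVec, Matrix.mul_nonsing_inv _ hdet, Matrix.one_mulVec, dotProduct_comm]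
  rw [h2] at h1
  rcases le_or_gt N 0 with hN0 | hN0
  · exact hN0.trans hc
  · nlinarith [h1, hN0]

/-- If `c · tᵀ A t < (y ⬝ t)²` for some `t`, with `A` positive definite and `c ≥ 0`, then
`c < yᵀ A⁻¹ y` (Cauchy–Schwarz for `A` with `u = A⁻¹ y`). [folklore] -/
theorem lt_dotProduct_inv_mulVec [DecidableEq ι] {A : Matrix ι ι ℝ} (hA : A.PosDef) {y t : ι → ℝ}
    {c : ℝ} (h : c * (t ⬝ᵥ A *ᵥ t) < (y ⬝ᵥ t) ^ 2) :
    c < y ⬝ᵥ A⁻¹ *ᵥ y := by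
  have hdet : IsUnit A.det := (Matrix.isUnit_iff_isUnit_det _).1 hA.isUnit
  have ht : t ≠ 0 := by
    rintro rfl
    simp at h
  have htpos : 0 < t ⬝ᵥ A *ᵥ t := by
    simpa using hA.dotProduct_mulVec_pos ht
  -- Cauchy–Schwarz with `u = A⁻¹ y`
  have hcs := sq_dotProduct_mulVec_le hA.posSemidef (A⁻¹ *ᵥ y) t
  have e1 : (A⁻¹ *ᵥ y) ⬝ᵥ A *ᵥ t = y ⬝ᵥ t := by
    rw [dotProduct_mulVec_comm hA.1, Matrix.mulVec_mulVec, Matrix.mul_nonsing_inv _ hdet,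
      Matrix.one_mulVec, dotProduct_comm]
  have e2 : (A⁻¹ *ᵥ y) ⬝ᵥ A *ᵥ (A⁻¹ *ᵥ y) = y ⬝ᵥ A⁻¹ *ᵥ y := by
    rw [Matrix.mulVec_mulVec, Matrix.mul_nonsing_inv _ hdet, Matrix.one_mulVec, dotProduct_comm]
  rw [e1, e2] at hcs
  by_contra hle
  push Not at hle
  have : (y ⬝ᵥ t) ^ 2 ≤ c * (t ⬝ᵥ A *ᵥ t) :=
    hcs.trans (mul_le_mul_of_nonneg_right hle htpos.le)
  linarith

/-! ### Fubini for characteristic functions -/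

variable {E : Type*} [NormedAddCommGroup E] [InnerProductSpace ℝ E] [MeasurableSpace E]
  [BorelSpace E] [SecondCountableTopology E]

/-- Fubini for characteristic functions of two finite measures on a Euclidean space:
`∫ ν̂ dγ = ∫ γ̂ dν`. Yamasaki 1985, Part A §17, the "Fourier transform" step (17.4) in the
proof of Thm 17.1. [cite: Yamasaki1985, Part A §17, proof of Thm 17.1, (17.4)] -/
theorem integral_charFun_comm (ν γ : Measure E) [IsFiniteMeasure ν] [IsFiniteMeasure γ] :
    ∫ t, charFun ν t ∂γ = ∫ y, charFun γ y ∂ν := by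
  simp_rw [charFun_apply]
  have hint : Integrable (Function.uncurry fun (t : E) (y : E) => cexp (⟪y, t⟫ * I)) (γ.prod ν) := by
    refine (integrable_const (1 : ℝ)).mono' (by fun_prop) (Filter.Eventually.of_forall fun p => ?_)
    simp only [Function.uncurry]
    rw [Complex.norm_exp_ofReal_mul_I]
  rw [integral_integral_swap hint]
  simp_rw [real_inner_comm]

/-! ### Gaussian integrals -/

section Gaussian

variable [DecidableEq ι]

/-- The characteristic function of the centred Gaussian `N(0, S)` on `ℝ^ι` is the real number
`exp (-tᵀ S t / 2)` (Mathlib `charFun_multivariateGaussian`). [folklore] -/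
theorem charFun_multivariateGaussian_zero {S : Matrix ι ι ℝ} (hS : S.PosSemidef)
    (y : EuclideanSpace ℝ ι) :
    charFun (multivariateGaussian 0 S) y =
      ((Real.exp (-(ofLp y ⬝ᵥ S *ᵥ ofLp y) / 2) : ℝ) : ℂ) := by
  rw [charFun_multivariateGaussian hS, inner_zero_right]
  simp only [ofReal_zero, zero_mul, zero_sub, Complex.ofReal_exp, Complex.ofReal_div,
    Complex.ofReal_neg, Complex.ofReal_ofNat, neg_div]

/-- Second moments of a centred Gaussian: `∫ ⟪a, t⟫² dN(0, S)(t) = aᵀ S a`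
(Mathlib `covarianceBilin_multivariateGaussian`). Yamasaki 1985, Part A §17, the computation
`E(sₙ sₘ) = α δₙₘ` between (17.5) and (17.6). [cite: Yamasaki1985, Part A §17, proof of Thm 17.1, (17.5)–(17.6)] -/
theorem integral_sq_inner_multivariateGaussian {S : Matrix ι ι ℝ} (hS : S.PosSemidef)
    (a : EuclideanSpace ℝ ι) :
    ∫ t, ⟪a, t⟫ ^ 2 ∂(multivariateGaussian 0 S) = ofLp a ⬝ᵥ S *ᵥ ofLp a := by
  have h := covarianceBilin_apply (μ := multivariateGaussian 0 S) IsGaussian.memLp_two_id a a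
  rw [covarianceBilin_multivariateGaussian hS] at h
  rw [h]
  refine integral_congr_ae (Filter.Eventually.of_forall fun t => ?_)
  simp only [id_eq, integral_id_multivariateGaussian, sub_zero, pow_two]

/-- Term-by-term integration of `t ↦ ∑ₙ ⟪aₙ, t⟫²` against a centred Gaussian `N(0, S)`:
if `aₙᵀ S aₙ ≤ cₙ` with `∑ cₙ < ∞` then `∫ ∑ₙ ⟪aₙ, t⟫² dN(0,S) ≤ ∑ cₙ` (monotone convergence).
Yamasaki 1985, Part A §17, passage from (17.5) to (17.6). [cite: Yamasaki1985, Part A §17, proof of Thm 17.1, (17.6)] -/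
theorem integral_tsum_sq_inner_le {S : Matrix ι ι ℝ} (hS : S.PosSemidef)
    (a : ℕ → EuclideanSpace ℝ ι) (c : ℕ → ℝ) (hc : Summable c)
    (hac : ∀ n, ofLp (a n) ⬝ᵥ S *ᵥ ofLp (a n) ≤ c n)
    (hsum : ∀ t, Summable fun n => ⟪a n, t⟫ ^ 2) :
    Integrable (fun t => ∑' n, ⟪a n, t⟫ ^ 2) (multivariateGaussian 0 S) ∧
      ∫ t, ∑' n, ⟪a n, t⟫ ^ 2 ∂(multivariateGaussian 0 S) ≤ ∑' n, c n := by
  set γ := multivariateGaussian 0 S with hγ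
  have hint : ∀ n, Integrable (fun t => ⟪a n, t⟫ ^ 2) γ := fun n =>
    (IsGaussian.memLp_two_id.const_inner (a n)).integrable_sq
  have hc0 : ∀ n, 0 ≤ c n := fun n => by
    have := hS.dotProduct_mulVec_nonneg (ofLp (a n))
    rw [star_trivial] at this
    exact this.trans (hac n)
  have hmeas_n : ∀ n, Measurable fun t : EuclideanSpace ℝ ι => ENNReal.ofReal (⟪a n, t⟫ ^ 2) :=
    fun n => ENNReal.measurable_ofReal.comp (by fun_prop)
  have hGmeas : Measurable fun t : EuclideanSpace ℝ ι => ∑' n, ⟪a n, t⟫ ^ 2 :=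
    Measurable.tsum fun n => by fun_prop
  have hG0 : ∀ t, 0 ≤ ∑' n, ⟪a n, t⟫ ^ 2 := fun t => tsum_nonneg fun n => sq_nonneg _
  have hlin : ∫⁻ t, ENNReal.ofReal (∑' n, ⟪a n, t⟫ ^ 2) ∂γ =
      ∑' n, ENNReal.ofReal (∫ t, ⟪a n, t⟫ ^ 2 ∂γ) := by
    calc ∫⁻ t, ENNReal.ofReal (∑' n, ⟪a n, t⟫ ^ 2) ∂γ
        = ∫⁻ t, ∑' n, ENNReal.ofReal (⟪a n, t⟫ ^ 2) ∂γ :=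
          lintegral_congr fun t => ENNReal.ofReal_tsum_of_nonneg (fun n => sq_nonneg _) (hsum t)
      _ = ∑' n, ∫⁻ t, ENNReal.ofReal (⟪a n, t⟫ ^ 2) ∂γ :=
          lintegral_tsum fun n => (hmeas_n n).aemeasurable
      _ = ∑' n, ENNReal.ofReal (∫ t, ⟪a n, t⟫ ^ 2 ∂γ) :=
          tsum_congr fun n => (ofReal_integral_eq_lintegral_ofReal (hint n)
            (Filter.Eventually.of_forall fun t => sq_nonneg _)).symm
  have hle : ∫⁻ t, ENNReal.ofReal (∑' n, ⟪a n, t⟫ ^ 2) ∂γ ≤ ENNReal.ofReal (∑' n, c n) := by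
    rw [hlin, ENNReal.ofReal_tsum_of_nonneg hc0 hc]
    refine ENNReal.tsum_le_tsum fun n => ENNReal.ofReal_le_ofReal ?_
    rw [integral_sq_inner_multivariateGaussian hS]
    exact hac n
  have hGint : Integrable (fun t => ∑' n, ⟪a n, t⟫ ^ 2) γ := by
    refine ⟨hGmeas.aestronglyMeasurable, ?_⟩
    rw [hasFiniteIntegral_iff_ofReal (Filter.Eventually.of_forall hG0)]
    exact hle.trans_lt ENNReal.ofReal_lt_top
  refine ⟨hGint, ?_⟩
  rw [integral_eq_lintegral_of_nonneg_ae (Filter.Eventually.of_forall hG0)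
    hGmeas.aestronglyMeasurable]
  exact ENNReal.toReal_le_of_le_ofReal (tsum_nonneg hc0) hle

/-- Real part of the Fubini identity for a centred Gaussian `γ` and a probability measure `ν`:
`∫ (1 - Re ν̂) dγ = ∫ (1 - exp(-yᵀ S y / 2)) dν(y)`. Yamasaki 1985, Part A §17, (17.3)–(17.4).
[cite: Yamasaki1985, Part A §17, proof of Thm 17.1, (17.3)–(17.4)] -/
theorem integral_one_sub_re_charFun {S : Matrix ι ι ℝ} (hS : S.PosSemidef)
    (ν : Measure (EuclideanSpace ℝ ι)) [IsProbabilityMeasure ν] :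
    ∫ t, (1 - (charFun ν t).re) ∂(multivariateGaussian 0 S) =
      ∫ y, (1 - Real.exp (-(ofLp y ⬝ᵥ S *ᵥ ofLp y) / 2)) ∂ν := by
  set γ := multivariateGaussian 0 S with hγ
  have hcf_int : Integrable (fun t => charFun ν t) γ :=
    (integrable_const (1 : ℝ)).mono' stronglyMeasurable_charFun.aestronglyMeasurable
      (Filter.Eventually.of_forall fun t => norm_charFun_le_one t)
  have hre_int : Integrable (fun t => (charFun ν t).re) γ := hcf_int.re
  have h1 := integral_charFun_comm ν γ
  have h2 : ∫ y, charFun γ y ∂ν =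
      ((∫ y, Real.exp (-(ofLp y ⬝ᵥ S *ᵥ ofLp y) / 2) ∂ν : ℝ) : ℂ) := by
    rw [← integral_complex_ofReal]
    exact integral_congr_ae (Filter.Eventually.of_forall fun y =>
      charFun_multivariateGaussian_zero hS y)
  have h3 : ∫ t, (charFun ν t).re ∂γ = ∫ y, Real.exp (-(ofLp y ⬝ᵥ S *ᵥ ofLp y) / 2) ∂ν := by
    have := Complex.reCLM.integral_comp_comm hcf_int
    simp only [Complex.reCLM_apply] at this
    rw [this, h1, h2, Complex.ofReal_re]
  have hexp_int : Integrable (fun y : EuclideanSpace ℝ ι =>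
      Real.exp (-(ofLp y ⬝ᵥ S *ᵥ ofLp y) / 2)) ν := by
    refine (integrable_const (1 : ℝ)).mono' (by fun_prop : Continuous fun y : EuclideanSpace ℝ ι =>
      Real.exp (-(ofLp y ⬝ᵥ S *ᵥ ofLp y) / 2)).aestronglyMeasurable
      (Filter.Eventually.of_forall fun y => ?_)
    rw [Real.norm_eq_abs, abs_of_nonneg (Real.exp_pos _).le, Real.exp_le_one_iff]
    have := hS.dotProduct_mulVec_nonneg (ofLp y)
    rw [star_trivial] at this
    linarith
  rw [integral_sub (integrable_const _) hre_int, integral_sub (integrable_const _) hexp_int, h3]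
  simp

end Gaussian

/-! ### The Minlos–Sazonov finite-dimensional estimate -/

variable [DecidableEq ι]

/-- **Minlos–Sazonov estimate** (finite-dimensional). Let `ν` be a probability measure on `ℝ^ι`
whose characteristic function satisfies `1 - Re ν̂(t) ≤ ε + 2 ∑ₙ ⟪aₙ, t⟫²`, where the linear
forms `⟪aₙ, ·⟫` are dominated by a positive semidefinite quadratic form `tᵀ M t` with
square-summable constants, `⟪aₙ, t⟫² ≤ bₙ² tᵀ M t`, `∑ bₙ² ≤ C`. Then for every `R > 0` the set of
`y` violating `⟪y, t⟫² ≤ R² tᵀ M t` for some `t` has measure at most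
`(ε + 2C/R²) / (1 - e^{-1/2})`. This is the finite-dimensional content of Minlos' theorem in
the form of Yamasaki 1985, Part A §17, proof of Thm 17.1 ((17.3)–(17.7)) and Thm 18.2, with
Markov's inequality replacing the limit `α → 0` there. [cite: Yamasaki1985, Part A §17, Thm 17.1 (proof, (17.3)–(17.7)) and §18 Thm 18.2] [cite: Minlos1959] -/
theorem measure_setOf_sq_inner_gt_le (ν : Measure (EuclideanSpace ℝ ι)) [IsProbabilityMeasure ν]
    {M : Matrix ι ι ℝ} (hM : M.PosSemidef) (a : ℕ → EuclideanSpace ℝ ι) (b : ℕ → ℝ)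
    {ε C R : ℝ} (hR : 0 < R)
    (hab : ∀ n t, ⟪a n, t⟫ ^ 2 ≤ b n ^ 2 * (ofLp t ⬝ᵥ M *ᵥ ofLp t))
    (hb : Summable fun n => b n ^ 2) (hbC : ∑' n, b n ^ 2 ≤ C)
    (hν : ∀ t, 1 - (charFun ν t).re ≤ ε + 2 * ∑' n, ⟪a n, t⟫ ^ 2) :
    ν {y | ∃ t, R ^ 2 * (ofLp t ⬝ᵥ M *ᵥ ofLp t) < ⟪y, t⟫ ^ 2}
      ≤ ENNReal.ofReal ((ε + 2 * C / R ^ 2) / (1 - Real.exp (-1 / 2))) := by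
  set κ : ℝ := 1 - Real.exp (-1 / 2) with hκ
  have hκ0 : 0 < κ := sub_pos.2 (Real.exp_lt_one_iff.2 (by norm_num))
  have hsum : ∀ t, Summable fun n => ⟪a n, t⟫ ^ 2 := fun t =>
    Summable.of_nonneg_of_le (fun n => sq_nonneg _) (fun n => hab n t) (hb.mul_right _)
  have hR2 : 0 < R ^ 2 := by positivity
  -- inner products versus dot products
  have hinner : ∀ x t : EuclideanSpace ℝ ι, ⟪x, t⟫ = ofLp x ⬝ᵥ ofLp t := fun x t => by
    rw [EuclideanSpace.inner_eq_star_dotProduct, star_trivial, dotProduct_comm]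
  -- Step A: the regularised bound
  have key : ∀ δ : ℝ, 0 < δ →
      ν {y | R ^ 2 < ofLp y ⬝ᵥ (M + δ • (1 : Matrix ι ι ℝ))⁻¹ *ᵥ ofLp y}
        ≤ ENNReal.ofReal ((ε + 2 * C / R ^ 2) / κ) := by
    intro δ hδ
    set Mδ := M + δ • (1 : Matrix ι ι ℝ) with hMδ_def
    have hMδ : Mδ.PosDef := Matrix.PosDef.posSemidef_add hM (Matrix.PosDef.one.smul hδ)
    have hMδ_ge : ∀ t, t ⬝ᵥ M *ᵥ t ≤ t ⬝ᵥ Mδ *ᵥ t := fun t => by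
      rw [hMδ_def, add_mulVec, smul_mulVec, one_mulVec, dotProduct_add, dotProduct_smul,
        smul_eq_mul]
      have h0 : 0 ≤ t ⬝ᵥ t := by
        have := dotProduct_star_self_nonneg t
        rwa [star_trivial] at this
      nlinarith [h0, hδ.le]
    set S : Matrix ι ι ℝ := (R ^ 2)⁻¹ • Mδ⁻¹ with hS_def
    have hS : S.PosSemidef := hMδ.inv.posSemidef.smul (inv_nonneg.2 hR2.le)
    have hS_apply : ∀ y, y ⬝ᵥ S *ᵥ y = (R ^ 2)⁻¹ * (y ⬝ᵥ Mδ⁻¹ *ᵥ y) := fun y => by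
      rw [hS_def, smul_mulVec, dotProduct_smul, smul_eq_mul]
    set γ := multivariateGaussian (0 : EuclideanSpace ℝ ι) S with hγ
    set f : EuclideanSpace ℝ ι → ℝ := fun y => 1 - Real.exp (-(ofLp y ⬝ᵥ S *ᵥ ofLp y) / 2)
      with hf
    have hq0 : ∀ y : ι → ℝ, 0 ≤ y ⬝ᵥ S *ᵥ y := fun y => by
      have := hS.dotProduct_mulVec_nonneg y
      rwa [star_trivial] at this
    have hf_nonneg : ∀ y, 0 ≤ f y := fun y =>
      sub_nonneg.2 (Real.exp_le_one_iff.2 (by have := hq0 (ofLp y); linarith))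
    have hf_le : ∀ y, f y ≤ 1 := fun y => by
      simp only [hf]
      linarith [Real.exp_pos (-(ofLp y ⬝ᵥ S *ᵥ ofLp y) / 2)]
    have hf_cont : Continuous f := by
      simp only [hf]
      fun_prop
    have hf_int : Integrable f ν :=
      (integrable_const (1 : ℝ)).mono' hf_cont.aestronglyMeasurable
        (Filter.Eventually.of_forall fun y => by
          rw [Real.norm_eq_abs, abs_of_nonneg (hf_nonneg y)]; exact hf_le y)
    -- the Fubini identity
    have hid : ∫ y, f y ∂ν = ∫ t, (1 - (charFun ν t).re) ∂γ :=
      (integral_one_sub_re_charFun hS ν).symm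
    -- Markov
    have hlow : κ * ν.real {y | κ ≤ f y} ≤ ∫ y, f y ∂ν :=
      mul_meas_ge_le_integral_of_nonneg (Filter.Eventually.of_forall hf_nonneg) hf_int κ
    -- the upper bound
    have hac : ∀ n, ofLp (a n) ⬝ᵥ S *ᵥ ofLp (a n) ≤ b n ^ 2 / R ^ 2 := by
      intro n
      rw [hS_apply, inv_mul_eq_div, div_le_div_iff_of_pos_right hR2]
      refine dotProduct_inv_mulVec_le hMδ (sq_nonneg _) fun t => ?_
      have h1 := hab n (toLp 2 t)
      rw [hinner, ofLp_toLp] at h1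
      exact h1.trans (mul_le_mul_of_nonneg_left (hMδ_ge t) (sq_nonneg _))
    obtain ⟨hGint, hGle⟩ :=
      integral_tsum_sq_inner_le hS a (fun n => b n ^ 2 / R ^ 2) (hb.div_const _) hac hsum
    rw [← hγ] at hGint hGle
    have hcf_int : Integrable (fun t => charFun ν t) γ :=
      (integrable_const (1 : ℝ)).mono' stronglyMeasurable_charFun.aestronglyMeasurable
        (Filter.Eventually.of_forall fun t => norm_charFun_le_one t)
    have hre_int : Integrable (fun t => (charFun ν t).re) γ := hcf_int.re
    have hup : ∫ t, (1 - (charFun ν t).re) ∂γ ≤ ε + 2 * C / R ^ 2 := by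
      calc ∫ t, (1 - (charFun ν t).re) ∂γ
          ≤ ∫ t, (ε + 2 * ∑' n, ⟪a n, t⟫ ^ 2) ∂γ :=
            integral_mono ((integrable_const _).sub hre_int)
              ((integrable_const ε).add (hGint.const_mul 2)) fun t => hν t
        _ = ε + 2 * ∫ t, ∑' n, ⟪a n, t⟫ ^ 2 ∂γ := by
            rw [integral_add (integrable_const ε) (hGint.const_mul 2), integral_const,
              integral_const_mul]
            simp
        _ ≤ ε + 2 * ∑' n, b n ^ 2 / R ^ 2 := by gcongr
        _ ≤ ε + 2 * C / R ^ 2 := by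
            rw [tsum_div_const, mul_div_assoc]
            gcongr
    -- inclusion of events
    have hincl : {y : EuclideanSpace ℝ ι | R ^ 2 < ofLp y ⬝ᵥ Mδ⁻¹ *ᵥ ofLp y} ⊆ {y | κ ≤ f y} := by
      intro y hy
      simp only [Set.mem_setOf_eq] at hy ⊢
      have h1 : 1 ≤ ofLp y ⬝ᵥ S *ᵥ ofLp y := by
        rw [hS_apply, inv_mul_eq_div, le_div_iff₀ hR2]
        linarith
      simp only [hf, hκ]
      gcongr 1 - Real.exp ?_
      linarith
    -- combine
    calc ν {y | R ^ 2 < ofLp y ⬝ᵥ Mδ⁻¹ *ᵥ ofLp y}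
        ≤ ν {y | κ ≤ f y} := measure_mono hincl
      _ = ENNReal.ofReal (ν.real {y | κ ≤ f y}) := (ENNReal.ofReal_toReal (measure_ne_top _ _)).symm
      _ ≤ ENNReal.ofReal ((ε + 2 * C / R ^ 2) / κ) := by
          refine ENNReal.ofReal_le_ofReal ?_
          rw [le_div_iff₀ hκ0]
          nlinarith [hlow, hid, hup]
  -- Step B: exhaust by `δ = 1/(k+1) → 0`
  set A : ℕ → Set (EuclideanSpace ℝ ι) := fun k =>
    {y | R ^ 2 < ofLp y ⬝ᵥ (M + (1 / ((k : ℝ) + 1)) • (1 : Matrix ι ι ℝ))⁻¹ *ᵥ ofLp y} with hA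
  have hcover : {y : EuclideanSpace ℝ ι | ∃ t, R ^ 2 * (ofLp t ⬝ᵥ M *ᵥ ofLp t) < ⟪y, t⟫ ^ 2} ⊆
      ⋃ N : ℕ, ⋂ k : ℕ, ⋂ (_ : N ≤ k), A k := by
    rintro y ⟨t, ht⟩
    rw [hinner] at ht
    set u := ofLp t with hu_def
    set v := ofLp y with hv_def
    have hu : u ≠ 0 := by
      rintro h
      rw [h] at ht
      simp at ht
    have hupos : 0 < u ⬝ᵥ u := by
      have := dotProduct_self_star_pos_iff.2 hu
      rwa [star_trivial] at this
    set gap := (v ⬝ᵥ u) ^ 2 - R ^ 2 * (u ⬝ᵥ M *ᵥ u) with hgap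
    have hgap0 : 0 < gap := by rw [hgap]; linarith
    obtain ⟨N, hN⟩ := exists_nat_gt (R ^ 2 * (u ⬝ᵥ u) / gap)
    refine Set.mem_iUnion.2 ⟨N, Set.mem_iInter₂.2 fun k hk => ?_⟩
    simp only [hA, Set.mem_setOf_eq]
    have hδ : (0 : ℝ) < 1 / ((k : ℝ) + 1) := by positivity
    refine lt_dotProduct_inv_mulVec (Matrix.PosDef.posSemidef_add hM (Matrix.PosDef.one.smul hδ)) (t := u) ?_
    rw [add_mulVec, smul_mulVec, one_mulVec, dotProduct_add, dotProduct_smul, smul_eq_mul]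
    -- need: R² (uMu + δ u·u) < (v·u)², i.e. δ R² (u·u) < gap
    have hk' : R ^ 2 * (u ⬝ᵥ u) / gap < (k : ℝ) + 1 :=
      hN.trans_le (by exact_mod_cast Nat.le_succ_of_le hk)
    have hδ' : 1 / ((k : ℝ) + 1) * (R ^ 2 * (u ⬝ᵥ u)) < gap := by
      rw [div_lt_iff₀ hgap0] at hk'
      rw [one_div, inv_mul_lt_iff₀ (by positivity : (0 : ℝ) < (k : ℝ) + 1)]
      linarith
    nlinarith [hδ']
  have hmono : Monotone fun N : ℕ => ⋂ k : ℕ, ⋂ (_ : N ≤ k), A k := by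
    intro N N' hNN'
    exact Set.biInter_subset_biInter_left fun k (hk : N' ≤ k) => hNN'.trans hk
  calc ν {y | ∃ t, R ^ 2 * (ofLp t ⬝ᵥ M *ᵥ ofLp t) < ⟪y, t⟫ ^ 2}
      ≤ ν (⋃ N : ℕ, ⋂ k : ℕ, ⋂ (_ : N ≤ k), A k) := measure_mono hcover
    _ = ⨆ N : ℕ, ν (⋂ k : ℕ, ⋂ (_ : N ≤ k), A k) := hmono.measure_iUnion
    _ ≤ ENNReal.ofReal ((ε + 2 * C / R ^ 2) / κ) := by
        refine iSup_le fun N => (measure_mono ?_).trans (key (1 / ((N : ℝ) + 1)) (by positivity))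
        exact Set.biInter_subset_of_mem (le_refl N)

end MinlosSazonov

end Literature.Analysis.FunctionSpaces
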